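import Summits.QuantumFields.YangMills.Theorems.LuscherReductionTwistedTraceScalingBOCentralTransferSharp
import Summits.QuantumFields.YangMills.Theorems.LuscherReductionTwistedTraceScalingBOCentralEventually
import Summits.QuantumFields.YangMills.Theorems.LuscherReductionTwistedTraceScalingBOCentralWindow
import Summits.QuantumFields.YangMills.Theorems.LuscherReductionTwistedTraceScalingBOCentralSupport
import Summits.QuantumFields.YangMills.Theorems.LuscherReductionTwistedTraceScalingBOCapProfile
import Summits.QuantumFields.YangMills.Theorems.LuscherReductionTwistedTraceScalingFPWeightCore
import Summits.QuantumFields.YangMills.Theorems.LuscherReductionTwistedTraceScalingBTColourMean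
import Summits.QuantumFields.YangMills.Theorems.LuscherReductionTwistedTraceScalingBOCentralSchedule
import HarnessLib

/-!
# (D1) ★★★ THE CENTRAL TRANSFER ON SCHEDULE B — THIRD TWIN, WITH THE SHARP SMEARING WINDOW `{‖q(u_k)−1‖ ≤ β^{-1/2}ℓ³ ∧ L³S₁ ≤ β^{-1}}`
# (explicit-unit seat `ym-line-ftr-p1` g19, crux K1 `NearFlatRatioLaw`, line "ratepack_v2", stub `stub_C1rate`; memo `Lines/ratepack-v8-core-g19.md` §3)

★★★ `central_transfer_record_three` — VERBATIM lane A's `…BOCentralRecordTwo.central_transfer_record_two` (p-landed) except for the TWO smearing-window slots: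
quaternion radius `δu := powScale (1/2) β · btLog β ^ 3` (was `powScale (1/3) β`) and action ceiling `σ := powScale 1 β` (was `powScale (1/2) β`).  With these slots every
summand of the smearing transport exponent `η₀ = coreEta L β 0 δu T r_f Γ σ + coreEps1 + coreEps2(… σ)` is `O_L(ℓ^{12}β^{-1/2})` (the two summands linear in `δu`,
`192|E|βT²δu` and `5040N₃βr_f²δu`, and the valley-grade term `1728N_P βT²√σ` were `Θ(ℓ⁴β^{-1/3})`, `Θ(ℓ²β^{-1/3})`, `Θ(ℓ⁴β^{-1/4})` before), which is what the rate
`η = O(β^{-1/3})` of `stub_C1rate` needs (`…HODPotA.hODpot_A_of_quasimode`).  The window is ours to choose; the only discharges that see the slots non-generically are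
the window floor `a_W ≤ δu ∧ 12L³a_W⁴ ≤ σ` (`a_W = O(β^{-1/2}ℓ²)`, so `δu` cannot be taken smaller than that — hence the extra `ℓ`), the auxiliary fat-tube support
`|E|(8r_f + 2δu) < β^{-1/4}`, and `δu ≤ 1`; all three hold eventually.
Proof: lane A's driver with the three discharges replaced.  What is NOT here: the RATE `hi/lo − 1 = O(β^{-1/3})` (next files) and the quasimode form.
HONEST FRAMING: helper toward stub_C1rate of crux K1 (OPEN); R2b1 is a RECORD rung; no summit statement is proved; the YM gap is NOT proved.
-/

set_option autoImplicit false

noncomputable section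

open MeasureTheory Filter Topology Real
open scoped BigOperators RealInnerProductSpace
open Literature.MathematicalPhysics.QuantumFieldTheory
open Literature.MathematicalPhysics.QuantumLattice

namespace Summit.QuantumFields.YangMills.Theorems.FemtoTransferGap.TwoLattice.ConstTube

open Summit.QuantumFields.YangMills.Theorems.FemtoTransferGap
open Summit.QuantumFields.YangMills.Theorems.FemtoTransferGap.TwoLattice
open Summit.QuantumFields.YangMills.Theorems.FemtoTransferGap.TwoLattice.Avg
open Summit.QuantumFields.YangMills.Theorems.FemtoTransferGap.TwoLattice.Stiff
open Summit.QuantumFields.YangMills.Theorems.FemtoTransferGap.TwoLattice.GnChart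

variable {L : ℕ} [NeZero L]

set_option maxHeartbeats 1600000 in
/-- ★★★ **THE CENTRAL TRANSFER ON SCHEDULE B, EVENTUALLY — sharp smearing window** `{‖q(u_k)−1‖ ≤ β^{-1/2}ℓ³ ∧ L³S₁ ≤ β^{-1}}` (see the module docstring;
third twin of lane A's `central_transfer_record`). [cite: Luscher1983, §3] [cite: Wipf2021, §8.5.2] -/
theorem central_transfer_record_three (hL : Nonempty (NzSite L)) :
    ∃ Ksp MT KD B CL Cp : ℝ, ∀ᶠ β : ℝ in atTop, ∀ v' : Edge 3 L → Fin 3 → ℝ, v' ∈ capBalancedSet L →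
      (∀ (e : Edge 3 L) (c : Fin 3), |v' e c| ≤ (9 * (L : ℝ) * (5 * (powScale (1 / 2) β * btLog β ^ 2)) + (powScale 1 β))) → ‖linkEmbed L v'‖ ≤ (min (1 / 40) (powScale (1 / 2) β * btLog β)) / 12 →
    Real.exp (-(coreEta L β 0 (powScale (1 / 2) β * btLog β ^ 3) (9 * (L : ℝ) * (5 * (powScale (1 / 2) β * btLog β ^ 2)) + (powScale 1 β)) (min (1 / 40) (powScale (1 / 2) β * btLog β)) ((powScale 1 β) * Fintype.card (Site 3 L)) (powScale 1 β) + coreEps1 L β 0 (9 * (L : ℝ) * (5 * (powScale (1 / 2) β * btLog β ^ 2)) + (powScale 1 β)) (min (1 / 40) (powScale (1 / 2) β * btLog β)) + coreEps2 L β 0 (9 * (L : ℝ) * (5 * (powScale (1 / 2) β * btLog β ^ 2)) + (powScale 1 β)) (min (1 / 40) (powScale (1 / 2) β * btLog β)) (powScale 1 β))) *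
          (1 * (Real.exp (2 * β) ^ Fintype.card (Edge 3 L) * ((2 * π ^ 2)⁻¹ * ((1 + (8 * (9 * (L : ℝ) * (5 * (powScale (1 / 2) β * btLog β ^ 2)) + (powScale 1 β))) ^ 2)⁻¹) ^ 2) ^ Fintype.card (Edge 3 L) *
              Real.exp (-(2000 * Fintype.card (Plaquette 3 L) * (8 * (9 * (L : ℝ) * (5 * (powScale (1 / 2) β * btLog β ^ 2)) + (powScale 1 β))) ^ 3 * β)) * (fpZ (powScale 1 β) * ((1:ℝ) * Real.exp (-(((96 * (β / 2) + (β)) * (B * (powScale 1 β * btLog β ^ 3) + MT * (powScale 1 β * btLog β ^ 3) ^ 2) * (2 * ((((min (1 / 40) (powScale (1 / 2) β * btLog β)) / 12) + (9 / 10 * (min (1 / 40) (powScale (1 / 2) β * btLog β)))) + 14 * ((Fintype.card (Edge 3 L) : ℝ)) * (8 * (9 * (L : ℝ) * (5 * (powScale (1 / 2) β * btLog β ^ 2)) + (powScale 1 β))) ^ 2 + (CL * ((4 + 48 * Ksp) * (8 * (9 * (L : ℝ) * (5 * (powScale (1 / 2) β * btLog β ^ 2)) + (powScale 1 β)))) *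 (9 * Ksp * (8 * (9 * (L : ℝ) * (5 * (powScale (1 / 2) β * btLog β ^ 2)) + (powScale 1 β)))) + MT * (9 * Ksp * (8 * (9 * (L : ℝ) * (5 * (powScale (1 / 2) β * btLog β ^ 2)) + (powScale 1 β)))) ^ 2)) + (B * (powScale 1 β * btLog β ^ 3) + MT * (powScale 1 β * btLog β ^ 3) ^ 2))) + ((96 * (β / 2) + (β)) * ((CL * ((4 + 48 * Ksp) * (8 * (9 * (L : ℝ) * (5 * (powScale (1 / 2) β * btLog β ^ 2)) + (powScale 1 β)))) * (9 * Ksp * (8 * (9 * (L : ℝ) * (5 * (powScale (1 / 2) β * btLog β ^ 2)) + (powScale 1 β)))) + MT * (9 * Ksp * (8 * (9 * (L : ℝ) * (5 * (powScale (1 / 2) β * btLog β ^ 2)) + (powScale 1 β)))) ^ 2) * (2 * ((((min (1 / 40) (powScale (1 / 2) β * btLog β)) / 12) + (9 / 10 * (min (1 / 40) (powScale (1 / 2) β * btLog β)))) + 14 * ((Fintype.card (Edge 3 L) : ℝ)) * (8 * (9 * (L : ℝ) * (5 * (powScale (1 / 2) β * btLog β ^ 2)) + (powScale 1 β))) ^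 2 + (CL * ((4 + 48 * Ksp) * (8 * (9 * (L : ℝ) * (5 * (powScale (1 / 2) β * btLog β ^ 2)) + (powScale 1 β)))) * (9 * Ksp * (8 * (9 * (L : ℝ) * (5 * (powScale (1 / 2) β * btLog β ^ 2)) + (powScale 1 β)))) + MT * (9 * Ksp * (8 * (9 * (L : ℝ) * (5 * (powScale (1 / 2) β * btLog β ^ 2)) + (powScale 1 β)))) ^ 2)) + (CL * ((4 + 48 * Ksp) * (8 * (9 * (L : ℝ) * (5 * (powScale (1 / 2) β * btLog β ^ 2)) + (powScale 1 β)))) * (9 * Ksp * (8 * (9 * (L : ℝ) * (5 * (powScale (1 / 2) β * btLog β ^ 2)) + (powScale 1 β)))) + MT * (9 * Ksp * (8 * (9 * (L : ℝ) * (5 * (powScale (1 / 2) β * btLog β ^ 2)) + (powScale 1 β)))) ^ 2)) + 72 * ((Fintype.card (Edge 3 L) : ℝ)) * (8 * (9 * (L : ℝ) * (5 * (powScale (1 / 2) β * btLog β ^ 2)) + (powScale 1 β))) ^ 3)))) * ((fpWeightBar L (powScale 1 β) * (1 - Cp * (1 * powScale (1 / 4) β) ^ 2)) - ((1 + KD *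 ((4 + 48 * Ksp) * (8 * (9 * (L : ℝ) * (5 * (powScale (1 / 2) β * btLog β ^ 2)) + (powScale 1 β)))) ^ 2) * (4 : ℝ) ^ (flatDim L / 2 : ℝ) * Real.exp (-((1 / (4 * sliceConst L)) ^ 2 * (powScale 1 β * btLog β ^ 3) ^ 2 / (4 * (powScale 1 β) ^ 2))) * fpWeightBar L (powScale 1 β))))) *
            (Real.exp (-(882 * β * (9 * (L : ℝ) * (5 * (powScale (1 / 2) β * btLog β ^ 2)) + (powScale 1 β)) ^ 2 * ((min (1 / 40) (powScale (1 / 2) β * btLog β)) / 12) ^ 2)) -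
              Real.exp (49 * β * ((min (1 / 40) (powScale (1 / 2) β * btLog β)) / 12) ^ 2) * (Real.exp (-(β * (min ((8 * (9 * (L : ℝ) * (5 * (powScale (1 / 2) β * btLog β ^ 2)) + (powScale 1 β))) - 2 * (9 * (L : ℝ) * (5 * (powScale (1 / 2) β * btLog β ^ 2)) + (powScale 1 β))) ((9 / 10 * (min (1 / 40) (powScale (1 / 2) β * btLog β))) - 6 * (9 * (L : ℝ) * (5 * (powScale (1 / 2) β * btLog β ^ 2)) + (powScale 1 β)) ^ 2 * ((min (1 / 40) (powScale (1 / 2) β * btLog β)) / 12))) ^ 2 / 2)) * (π / (β / 2)) ^ ((Module.finrank ℝ (LinkSpace L) : ℝ) / 2)) /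
                stiffGaussTop L (β / 2) β)) *
            (stiffGaussTop L (β / 2) β * Real.exp (-stiffGaussExp L (β / 2) β (linkEmbed L v')))) /
          (∫ u, ({u : GaugeConfig 3 1 SU2 | (∀ k : Fin 3, ‖su2Quat (u (0, k)) - 1‖ ≤ (powScale (1 / 2) β * btLog β ^ 3)) ∧ (L : ℝ) ^ 3 * wilsonAction su2Rep u ≤ (powScale 1 β)}.indicator (fun _ => (1 : ℝ))) u * (transferKernel su2Rep ((L : ℝ) ^ 3 * β) (1 : GaugeConfig 3 1 SU2) u / transferKernel su2Rep ((L : ℝ) ^ 3 * β) (1 : GaugeConfig 3 1 SU2) 1)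
            ∂configMeasure SU2 1) ≤ fpFibreTransfer L β (fun x : LinkSpace L => {x : LinkSpace L | linkCurry x ∈ capBalancedSet L}.indicator (fun _ => (1 : ℝ)) x * frozenProfile L (fun β' => stiffGaussExp L (β' / 2) β') (fun β' => min (1 / 40) (powScale (1 / 2) β' * btLog β')) β x) (coreWeight L (powScale 1 β) (5 * (powScale (1 / 2) β * btLog β ^ 2))) (orthoTube L 1 v') 1 ∧
      fpFibreTransfer L β (fun x : LinkSpace L => {x : LinkSpace L | linkCurry x ∈ capBalancedSet L}.indicator (fun _ => (1 : ℝ)) x * frozenProfile L (fun β' => stiffGaussExp L (β' / 2) β') (fun β' => min (1 / 40) (powScale (1 / 2) β' * btLog β')) β x) (coreWeight L (powScale 1 β) (5 * (powScale (1 / 2) β * btLog β ^ 2))) (orthoTube L 1 v') 1 ≤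
        Real.exp (coreEta L β 0 (powScale (1 / 2) β * btLog β ^ 3) (9 * (L : ℝ) * (5 * (powScale (1 / 2) β * btLog β ^ 2)) + (powScale 1 β)) (min (1 / 40) (powScale (1 / 2) β * btLog β)) ((powScale 1 β) * Fintype.card (Site 3 L)) (powScale 1 β) + coreEps1 L β 0 (9 * (L : ℝ) * (5 * (powScale (1 / 2) β * btLog β ^ 2)) + (powScale 1 β)) (min (1 / 40) (powScale (1 / 2) β * btLog β)) + coreEps2 L β 0 (9 * (L : ℝ) * (5 * (powScale (1 / 2) β * btLog β ^ 2)) + (powScale 1 β)) (min (1 / 40) (powScale (1 / 2) β * btLog β)) (powScale 1 β)) *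
          (1 * (Real.exp (2 * β) ^ Fintype.card (Edge 3 L) * ((2 * π ^ 2)⁻¹) ^ Fintype.card (Edge 3 L) * Real.exp (2000 * Fintype.card (Plaquette 3 L) * (8 * (9 * (L : ℝ) * (5 * (powScale (1 / 2) β * btLog β ^ 2)) + (powScale 1 β))) ^ 3 * β) *
                Real.exp (8 * Fintype.card (Edge 3 L) * β * (8 * (9 * (L : ℝ) * (5 * (powScale (1 / 2) β * btLog β ^ 2)) + (powScale 1 β))) ^ 4) * (fpZ (powScale 1 β) * (1:ℝ) * (Real.exp (((96 * (β / 2) + (β)) * (B * (powScale 1 β * btLog β ^ 3) + MT * (powScale 1 β * btLog β ^ 3) ^ 2) * (2 * (Real.sqrt ((Fintype.card (Edge 3 L) : ℝ)) * (8 * (9 * (L : ℝ) * (5 * (powScale (1 / 2) β * btLog β ^ 2)) + (powScale 1 β))) + (7 * ((Fintype.card (Edge 3 L) : ℝ)) * (8 * (9 * (L : ℝ) * (5 * (powScale (1 / 2) β * btLog β ^ 2)) + (powScale 1 β))) + B * (9 * Ksp * (8 * (9 * (L : ℝ) * (5 * (powScale (1 / 2) β * btLog β ^ 2)) + (powScale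 1 β)))) + MT * (9 * Ksp * (8 * (9 * (L : ℝ) * (5 * (powScale (1 / 2) β * btLog β ^ 2)) + (powScale 1 β)))) ^ 2)) + (B * (powScale 1 β * btLog β ^ 3) + MT * (powScale 1 β * btLog β ^ 3) ^ 2))) + ((96 * (β / 2) + (β)) * ((CL * ((4 + 48 * Ksp) * (8 * (9 * (L : ℝ) * (5 * (powScale (1 / 2) β * btLog β ^ 2)) + (powScale 1 β)))) * (9 * Ksp * (8 * (9 * (L : ℝ) * (5 * (powScale (1 / 2) β * btLog β ^ 2)) + (powScale 1 β)))) + MT * (9 * Ksp * (8 * (9 * (L : ℝ) * (5 * (powScale (1 / 2) β * btLog β ^ 2)) + (powScale 1 β)))) ^ 2) * (2 * (Real.sqrt ((Fintype.card (Edge 3 L) : ℝ)) * (8 * (9 * (L : ℝ) * (5 * (powScale (1 / 2) β * btLog β ^ 2)) + (powScale 1 β))) + (7 * ((Fintype.card (Edge 3 L) : ℝ)) * (8 * (9 * (L : ℝ) * (5 * (powScale (1 / 2) β * btLog β ^ 2)) + (powScale 1 β))) + B * (9 * Ksp * (8 * (9 * (L : ℝ) * (5 * (powScale (1 / 2) β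 * btLog β ^ 2)) + (powScale 1 β)))) + MT * (9 * Ksp * (8 * (9 * (L : ℝ) * (5 * (powScale (1 / 2) β * btLog β ^ 2)) + (powScale 1 β)))) ^ 2)) + (CL * ((4 + 48 * Ksp) * (8 * (9 * (L : ℝ) * (5 * (powScale (1 / 2) β * btLog β ^ 2)) + (powScale 1 β)))) * (9 * Ksp * (8 * (9 * (L : ℝ) * (5 * (powScale (1 / 2) β * btLog β ^ 2)) + (powScale 1 β)))) + MT * (9 * Ksp * (8 * (9 * (L : ℝ) * (5 * (powScale (1 / 2) β * btLog β ^ 2)) + (powScale 1 β)))) ^ 2)) + 72 * ((Fintype.card (Edge 3 L) : ℝ)) * (8 * (9 * (L : ℝ) * (5 * (powScale (1 / 2) β * btLog β ^ 2)) + (powScale 1 β))) ^ 3))) * (fpWeightBar L (powScale 1 β) * (1 + Cp * (1 * powScale (1 / 4) β) ^ 2)) + ((1 + KD * ((4 + 48 * Ksp) * (8 * (9 * (L : ℝ) * (5 * (powScale (1 / 2) β * btLog β ^ 2)) + (powScale 1 β)))) ^ 2) * (4 : ℝ) ^ (flatDim L / 2 : ℝ) * Real.exp (-((1 / (4 * sliceConst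 L)) ^ 2 * (powScale 1 β * btLog β ^ 3) ^ 2 / (4 * (powScale 1 β) ^ 2))) * fpWeightBar L (powScale 1 β)) * Real.exp ((96 * (β / 2) + (β)) * (Real.sqrt ((Fintype.card (Edge 3 L) : ℝ)) * (8 * (9 * (L : ℝ) * (5 * (powScale (1 / 2) β * btLog β ^ 2)) + (powScale 1 β)))) ^ 2))) * Real.exp (882 * β * (9 * (L : ℝ) * (5 * (powScale (1 / 2) β * btLog β ^ 2)) + (powScale 1 β)) ^ 2 * ((min (1 / 40) (powScale (1 / 2) β * btLog β)) / 12) ^ 2) +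
              (1:ℝ) * (1:ℝ) * 1 * (Real.exp (2 * β) ^ Fintype.card (Edge 3 L) * Real.exp (-(β * (8 * (9 * (L : ℝ) * (5 * (powScale (1 / 2) β * btLog β ^ 2)) + (powScale 1 β))) ^ 2 / 4))) * Real.exp (49 * β * ((min (1 / 40) (powScale (1 / 2) β * btLog β)) / 12) ^ 2) / stiffGaussTop L (β / 2) β) *
            (stiffGaussTop L (β / 2) β * Real.exp (-stiffGaussExp L (β / 2) β (linkEmbed L v')))) /
          (∫ u, ({u : GaugeConfig 3 1 SU2 | (∀ k : Fin 3, ‖su2Quat (u (0, k)) - 1‖ ≤ (powScale (1 / 2) β * btLog β ^ 3)) ∧ (L : ℝ) ^ 3 * wilsonAction su2Rep u ≤ (powScale 1 β)}.indicator (fun _ => (1 : ℝ))) u * (transferKernel su2Rep ((L : ℝ) ^ 3 * β) (1 : GaugeConfig 3 1 SU2) u / transferKernel su2Rep ((L : ℝ) ^ 3 * β) (1 : GaugeConfig 3 1 SU2) 1)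
            ∂configMeasure SU2 1) := by
  -- (N2) toolchain constants (as in `…FPWeightCore.fpWeight_core_constant`)
  obtain ⟨Ksp, εsp, hKsp, hεsp, hSP⟩ := exists_slicePoint L
  obtain ⟨MT, εT, hMT, hεT, hT⟩ := exists_taylor_two_basedFn L
  obtain ⟨εC, hεC, hC⟩ := exists_uniform_coercive_basedLin L
  obtain ⟨εI, hεI, hI'⟩ := Metric.eventually_nhds_iff.mp (laplaceIntegral_eq L)
  have hI : ∀ q : balancedSubmodule L × (Fin 3 → Fin 3 → ℝ), ‖q‖ < εI → ∀ {a s' : ℝ}, 0 < a → 0 < s' →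
      ∫ w, Real.exp (-(a * ‖laplaceMap L q w‖ ^ 2 / s' ^ 2)) ∂(volume : Measure (NzSite L → Fin 3 → ℝ)) =
        (π * s' ^ 2 / a) ^ (flatDim L / 2 : ℝ) / Real.sqrt (gramDet L q) :=
    fun q hq => hI' (by rwa [dist_zero_right])
  obtain ⟨KD, εD, hKD, hεD, hD⟩ := exists_gramDet_ratio_bound L
  obtain ⟨εL, hεL, hball⟩ := Metric.eventually_nhds_iff.mp (eventually_norm_basedLin_sub_le L)
  set CL : ℝ := 1144 * Real.sqrt (3 * Fintype.card (Edge 3 L)) with hCLdef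
  have hCL : 0 ≤ CL := by rw [hCLdef]; positivity
  have hLip : ∀ q : balancedSubmodule L × (Fin 3 → Fin 3 → ℝ), ‖q‖ < εL → ∀ ξ : basedSubmodule L, ‖(basedLin L q - basedLin L 0) ξ‖ ≤ CL * ‖q‖ * ‖ξ‖ :=
    fun q hq ξ => hball (by rwa [dist_zero_right]) ξ
  set εB : ℝ := min εL (1 / (CL + 1)) with hεBdef
  have hεB : 0 < εB := lt_min hεL (by positivity)
  set B : ℝ := ‖basedLin L 0‖ + 1 with hBdef
  have hB0 : 0 ≤ B := by positivity
  have hB : ∀ q : balancedSubmodule L × (Fin 3 → Fin 3 → ℝ), ‖q‖ < εB → ‖basedLin L q‖ ≤ B := fun q hq => by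
    have hq1 : ‖q‖ < εL := lt_of_lt_of_le hq (min_le_left _ _)
    have hq2 : ‖q‖ < 1 / (CL + 1) := lt_of_lt_of_le hq (min_le_right _ _)
    have hop : ‖basedLin L q - basedLin L 0‖ ≤ CL * ‖q‖ :=
      ContinuousLinearMap.opNorm_le_bound _ (by positivity) fun ξ => by have := hLip q hq1 ξ; linarith
    have hRq : CL * ‖q‖ ≤ 1 := by
      have h1 : CL * ‖q‖ ≤ CL * (1 / (CL + 1)) := mul_le_mul_of_nonneg_left hq2.le hCL
      have h2 : CL * (1 / (CL + 1)) ≤ 1 := by rw [mul_one_div, div_le_one (by positivity)]; linarith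
      exact h1.trans h2
    have h3 := norm_le_insert' (basedLin L q) (basedLin L 0)
    rw [hBdef]; linarith
  -- (P) for the auxiliary fat tube `δ = β^{-1/4}`
  have hδ0 : ∀ β, 0 < (fun β : ℝ => 1 * powScale (1 / 4) β) β := fun β => by simpa using powScale_pos (1 / 4) β
  have hδt : Tendsto (fun β : ℝ => 1 * powScale (1 / 4) β) atTop (𝓝 0) := by simpa using tendsto_powScale (σ := 1 / 4) (by norm_num)
  have hsd : ∀ᶠ β in atTop, 0 < powScale 1 β ∧ powScale 1 β ≤ (fun β : ℝ => 1 * powScale (1 / 4) β) β ^ 3 := by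
    filter_upwards [eventually_ge_atTop (1 : ℝ)] with β hβ
    exact ⟨powScale_pos _ _, by simpa using powScale_one_le_cube (σ := 1 / 4) (by norm_num) hβ⟩
  obtain ⟨M', hM', hPM⟩ := fpWeight_core_constant L hL hδ0 hδt hsd
  obtain ⟨Cp, β₀, hCp, hP⟩ := hPM M' le_rfl
  refine ⟨Ksp, MT, KD, B, CL, Cp, ?_⟩
  have hCpos := sliceConst_pos L
  have hE1 : (1 : ℝ) ≤ Fintype.card (Edge 3 L) := by exact_mod_cast Fintype.card_pos
  -- elementary eventually facts
  have e1 := eventually_mul_lt_of_tendsto (tendsto_schedRho (L := L)) (4 + 48 * Ksp) hεT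
  have e2 := eventually_mul_lt_of_tendsto (tendsto_schedRho (L := L)) (4 + 48 * Ksp) hεL
  have e3 := eventually_mul_lt_of_tendsto (tendsto_schedRho (L := L)) (4 + 48 * Ksp) hεB
  have e4 := eventually_mul_le_of_tendsto (tendsto_schedRho (L := L)) (4 + 48 * Ksp) (by norm_num : (0:ℝ) < 1 / 40)
  have e5 := eventually_mul_lt_of_tendsto (tendsto_schedRho (L := L)) (9 * Ksp) hεT
  have e6 := eventually_mul_lt_of_tendsto (tendsto_schedRho (L := L)) (4 + 48 * Ksp) hεC
  have e7 := eventually_mul_lt_of_tendsto (tendsto_schedRho (L := L)) (4 + 48 * Ksp) hεI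
  have e8 := eventually_mul_lt_of_tendsto (tendsto_schedRho (L := L)) (4 + 48 * Ksp) hεD
  have e9 := eventually_mul_le_of_tendsto (tendsto_schedRho (L := L)) (|KD| * (4 + 48 * Ksp) ^ 2) (by norm_num : (0:ℝ) < 1 / 2)
  have e10 := eventually_mul_le_of_tendsto (tendsto_schedRho (L := L)) 1 (by norm_num : (0:ℝ) < 1 / 5)
  have e11 := eventually_mul_lt_of_tendsto (tendsto_schedRho (L := L)) 3 hεsp
  have e12 := eventually_mul_le_of_tendsto (tendsto_schedRho (L := L)) (3 * Ksp) (by norm_num : (0:ℝ) < 1 / 8)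
  have e13 := eventually_mul_le_of_tendsto (tendsto_schedRho (L := L)) ((2 + 24 * Ksp) ^ 2 / 4) (by norm_num : (0:ℝ) < 1 / 50)
  have e14 := eventually_mul_le_of_tendsto (tendsto_schedRho (L := L)) (9 * Ksp) (by norm_num : (0:ℝ) < 1 / 3)
  have e15 := eventually_mul_le_of_tendsto (tendsto_schedRho (L := L)) (4 * sliceConst L * MT * (9 * Ksp)) (by norm_num : (0:ℝ) < 1 / 2)
  have e16 := eventually_mul_le_of_tendsto (tendsto_schedT (L := L)) 1 (by norm_num : (0:ℝ) < 1 / 30)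
  have e17 := eventually_mul_le_of_tendsto (tendsto_schedCore) 1 (by norm_num : (0:ℝ) < 1 / 40)
  -- the auxiliary fat tube vs ρ, r
  have e18 := eventually_rho_lt_powScale (L := L) (s'' := 1 / 4) (by norm_num) (Real.sqrt 2 * Fintype.card (Edge 3 L)) one_pos
  have e19 := eventually_rho_lt_powScale (L := L) (s'' := 1 / 4) (by norm_num) (Real.sqrt 2) (by linarith : (0:ℝ) < M')
  have e22 := eventually_rho_lt_powScale (L := L) (s'' := 1 / 4) (by norm_num) (3 + 24 * Ksp) (by linarith : (0:ℝ) < M' / 2)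
  have e23 : ∀ᶠ β : ℝ in atTop, 8 * (powScale 1 β * btLog β ^ 3) < (M' / 2) * powScale (1 / 4) β := by
    -- `r = β^{-1}ℓ³ ≤ β^{-1/2}ℓ³·β^{-1/2} …`: use `r ≤ ρ`-free route: `8r < (M'/2)β^{-1/4}` since `r = β^{-1/4}·(β^{-3/4}ℓ³)` and `β^{-3/4}ℓ³ → 0`
    have h := eventually_mul_lt_of_tendsto (tendsto_powScale_mul_btLog_pow (p := 3 / 4) (by norm_num) 3) 8 (by linarith : (0:ℝ) < M' / 2)
    filter_upwards [h] with β hβ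
    have hsplit : powScale 1 β * btLog β ^ 3 = powScale (1 / 4) β * (powScale (3 / 4) β * btLog β ^ 3) := by
      rw [← mul_assoc, powScale_mul_powScale]; norm_num
    rw [hsplit]
    have hx0 : 0 < powScale (1 / 4) β := powScale_pos _ _
    nlinarith
  -- Laplace support radius `R₁`, based radius, their smallness
  have hRt : Tendsto (fun β : ℝ => (3 * ((L : ℝ) - 1) * (((3 + 24 * Ksp) * (8 * (9 * (L : ℝ) * (5 * (powScale (1 / 2) β * btLog β ^ 2)) + (powScale 1 β)))) + (M' * (1 * powScale (1 / 4) β))) + (powScale 1 β * btLog β ^ 3))) atTop (𝓝 0) := by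
    have h1 := ((tendsto_schedRho (L := L)).const_mul (3 + 24 * Ksp))
    have h2 := hδt.const_mul M'
    have h3 := ((h1.add h2).const_mul (3 * ((L : ℝ) - 1))).add tendsto_schedCore
    simp only [mul_zero, add_zero] at h3
    exact h3
  have hRbt : Tendsto (fun β : ℝ => 3 * ((L : ℝ) - 1) * (((3 + 24 * Ksp) * (8 * (9 * (L : ℝ) * (5 * (powScale (1 / 2) β * btLog β ^ 2)) + (powScale 1 β)))) + (M' * (1 * powScale (1 / 4) β)))) atTop (𝓝 0) := by
    have h1 := ((tendsto_schedRho (L := L)).const_mul (3 + 24 * Ksp))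
    have h2 := hδt.const_mul M'
    have h3 := (h1.add h2).const_mul (3 * ((L : ℝ) - 1))
    simp only [mul_zero, add_zero] at h3
    exact h3
  have e24 := eventually_mul_le_of_tendsto hRt 1 (by norm_num : (0:ℝ) < 1 / 2)
  have e25 := eventually_mul_lt_of_tendsto hRt 1 hεT
  have e26 := eventually_mul_le_of_tendsto hRt ((MT + 2 * B) * (4 * sliceConst L)) (by norm_num : (0:ℝ) < 1 / 4)
  have e27 := eventually_mul_le_of_tendsto hRbt 1 (by norm_num : (0:ℝ) < 1 / 3)
  have e28 := eventually_mul_lt_of_tendsto hRbt 1 hεT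
  have e29 := eventually_mul_le_of_tendsto hRbt (4 * sliceConst L * MT) (by norm_num : (0:ℝ) < 1 / 2)
  have e30 := eventually_mul_le_of_tendsto hδt M' (by norm_num : (0:ℝ) < 1 / 4)
  -- profile radius, jump, Laplace tail, window floor, support
  have e31 := eventually_rho_sq_core_le_rf (L := L) (14 * (Fintype.card (Edge 3 L) : ℝ) + CL * (4 + 48 * Ksp) * (9 * Ksp) + MT * (9 * Ksp) ^ 2) B MT (by norm_num : (0:ℝ) < 1 / 60)
  have e32 := eventually_jump (L := L) (sliceConst L) hCpos.le
  have e33 := eventually_laplace_tail_small (L := L) (c := 1 / (4 * sliceConst L)) (by positivity) KD Ksp Cp (flatDim L / 2 : ℝ) (s'' := 1 / 4) (by norm_num)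
  have e34 : ∀ᶠ β : ℝ in atTop, (min (1 / 40) (powScale (1 / 2) β * btLog β)) = powScale (1 / 2) β * btLog β := by
    filter_upwards [eventually_mul_le_of_tendsto tendsto_rf 1 (by norm_num : (0:ℝ) < 1 / 40)] with β h
    rw [one_mul] at h; exact min_eq_right h
  have e35 : ∀ᶠ β : ℝ in atTop, (2 * ((4 + 48 * Ksp) * (8 * (9 * (L : ℝ) * (5 * (powScale (1 / 2) β * btLog β ^ 2)) + (powScale 1 β)))) + 6 * (40 * (4 * (powScale 1 β * btLog β ^ 3) ^ 2 + 2 * (powScale 1 β * btLog β ^ 3) * ((4 + 48 * Ksp) * (8 * (9 * (L : ℝ) * (5 * (powScale (1 / 2) β * btLog β ^ 2)) + (powScale 1 β))))) + 3 * (powScale 1 β * btLog β ^ 3))) ≤ (powScale (1 / 2) β * btLog β ^ 3) ∧ (L : ℝ) ^ 3 * (12 * (2 * ((4 + 48 * Ksp) * (8 * (9 * (L : ℝ) * (5 * (powScale (1 / 2) β * btLog β ^ 2)) + (powScale 1 β)))) + 6 * (40 * (4 * (powScale 1 β * btLog β ^ 3) ^ 2 + 2 * (powScale 1 β * btLog β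 ^ 3) * ((4 + 48 * Ksp) * (8 * (9 * (L : ℝ) * (5 * (powScale (1 / 2) β * btLog β ^ 2)) + (powScale 1 β))))) + 3 * (powScale 1 β * btLog β ^ 3))) ^ 4) ≤ (powScale 1 β) := by
    -- compare with `β^{-1/2}ℓ³`: `a_W ≤ C·ρ + C'·r`, `ρ ≤ 8(45L+1)β^{-1/2}ℓ²`, `r = β^{-1}ℓ³`; the extra `ℓ` absorbs the constants; then `12L³a_W⁴ ≤ 12L³β^{-2}ℓ¹² ≤ β^{-1}`
    have hℓbig := (tendsto_btLog_atTop).eventually_ge_atTop (2 * ((2 * (4 + 48 * Ksp) + 6 * 40 * 2 * (4 + 48 * Ksp)) * (8 * (45 * (L : ℝ) + 1))))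
    have hrhalf := eventually_mul_le_of_tendsto (tendsto_powScale (σ := 1 / 2) (by norm_num)) (6 * 40 * 4 + 6 * 3) (by norm_num : (0:ℝ) < 1 / 2)
    have hwin := eventually_mul_le_of_tendsto (tendsto_powScale_mul_btLog_pow (p := 1) (by norm_num) 12) (12 * (L : ℝ) ^ 3) one_pos
    filter_upwards [hℓbig, hrhalf, hwin, eventually_ge_atTop (1 : ℝ), e17, e10] with β h1 h2 h3 hβ hr hρ1
    obtain ⟨hρ0, hρle⟩ := schedRho_bounds (L := L) hβ
    have hℓ1 := one_le_btLog β
    have hℓ0 : 0 ≤ btLog β := le_trans zero_le_one hℓ1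
    have hx0 : 0 < powScale (1 / 2) β := powScale_pos _ _
    have hs1 : 0 < powScale 1 β := powScale_pos _ _
    have hr0 : 0 ≤ (powScale 1 β * btLog β ^ 3) := mul_nonneg hs1.le (pow_nonneg hℓ0 3)
    rw [one_mul] at hr hρ1
    have hr1 : (powScale 1 β * btLog β ^ 3) ≤ 1 := by linarith
    have hKsp' : 0 ≤ 4 + 48 * Ksp := by linarith
    have hK0 : 0 ≤ (4 + 48 * Ksp) * (8 * (9 * (L : ℝ) * (5 * (powScale (1 / 2) β * btLog β ^ 2)) + (powScale 1 β))) := mul_nonneg hKsp' hρ0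
    have haw : (2 * ((4 + 48 * Ksp) * (8 * (9 * (L : ℝ) * (5 * (powScale (1 / 2) β * btLog β ^ 2)) + (powScale 1 β)))) + 6 * (40 * (4 * (powScale 1 β * btLog β ^ 3) ^ 2 + 2 * (powScale 1 β * btLog β ^ 3) * ((4 + 48 * Ksp) * (8 * (9 * (L : ℝ) * (5 * (powScale (1 / 2) β * btLog β ^ 2)) + (powScale 1 β))))) + 3 * (powScale 1 β * btLog β ^ 3))) ≤ 2 * ((4 + 48 * Ksp) * (8 * (9 * (L : ℝ) * (5 * (powScale (1 / 2) β * btLog β ^ 2)) + (powScale 1 β)))) + 6 * (40 * (4 * (powScale 1 β * btLog β ^ 3) + 2 * ((4 + 48 * Ksp) * (8 * (9 * (L : ℝ) * (5 * (powScale (1 / 2) β * btLog β ^ 2)) + (powScale 1 β))))) + 3 * (powScale 1 β * btLog β ^ 3)) := by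
      nlinarith [mul_le_of_le_one_left hr0 hr1, mul_le_of_le_one_left hK0 hr1]
    have hlin : 2 * ((4 + 48 * Ksp) * (8 * (9 * (L : ℝ) * (5 * (powScale (1 / 2) β * btLog β ^ 2)) + (powScale 1 β)))) + 6 * (40 * (4 * (powScale 1 β * btLog β ^ 3) + 2 * ((4 + 48 * Ksp) * (8 * (9 * (L : ℝ) * (5 * (powScale (1 / 2) β * btLog β ^ 2)) + (powScale 1 β))))) + 3 * (powScale 1 β * btLog β ^ 3)) = (2 * (4 + 48 * Ksp) + 6 * 40 * 2 * (4 + 48 * Ksp)) * (8 * (9 * (L : ℝ) * (5 * (powScale (1 / 2) β * btLog β ^ 2)) + (powScale 1 β))) + (6 * 40 * 4 + 6 * 3) * (powScale 1 β * btLog β ^ 3) := by ring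
    have hCρ : 0 ≤ (2 * (4 + 48 * Ksp) + 6 * 40 * 2 * (4 + 48 * Ksp)) := by nlinarith
    -- `Cρ·ρ ≤ (1/2)·β^{-1/2}ℓ³`
    have hA : (2 * (4 + 48 * Ksp) + 6 * 40 * 2 * (4 + 48 * Ksp)) * (8 * (9 * (L : ℝ) * (5 * (powScale (1 / 2) β * btLog β ^ 2)) + (powScale 1 β))) ≤ 1 / 2 * (powScale (1 / 2) β * btLog β ^ 3) := by
      have h1' : (2 * (4 + 48 * Ksp) + 6 * 40 * 2 * (4 + 48 * Ksp)) * (8 * (9 * (L : ℝ) * (5 * (powScale (1 / 2) β * btLog β ^ 2)) + (powScale 1 β))) ≤ (2 * (4 + 48 * Ksp) + 6 * 40 * 2 * (4 + 48 * Ksp)) * (8 * (45 * (L : ℝ) + 1) * (powScale (1 / 2) β * btLog β ^ 2)) :=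
        mul_le_mul_of_nonneg_left hρle hCρ
      have hpl2 : 0 ≤ powScale (1 / 2) β * btLog β ^ 2 := by positivity
      have h2' : ((2 * (4 + 48 * Ksp) + 6 * 40 * 2 * (4 + 48 * Ksp)) * (8 * (45 * (L : ℝ) + 1))) * (powScale (1 / 2) β * btLog β ^ 2) ≤ (1 / 2 * btLog β) * (powScale (1 / 2) β * btLog β ^ 2) :=
        mul_le_mul_of_nonneg_right (by linarith) hpl2
      calc (2 * (4 + 48 * Ksp) + 6 * 40 * 2 * (4 + 48 * Ksp)) * (8 * (9 * (L : ℝ) * (5 * (powScale (1 / 2) β * btLog β ^ 2)) + (powScale 1 β))) ≤ (2 * (4 + 48 * Ksp) + 6 * 40 * 2 * (4 + 48 * Ksp)) * (8 * (45 * (L : ℝ) + 1) * (powScale (1 / 2) β * btLog β ^ 2)) := h1'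
        _ = ((2 * (4 + 48 * Ksp) + 6 * 40 * 2 * (4 + 48 * Ksp)) * (8 * (45 * (L : ℝ) + 1))) * (powScale (1 / 2) β * btLog β ^ 2) := by ring
        _ ≤ (1 / 2 * btLog β) * (powScale (1 / 2) β * btLog β ^ 2) := h2'
        _ = 1 / 2 * (powScale (1 / 2) β * btLog β ^ 3) := by ring
    -- `Cr·r ≤ (1/2)·β^{-1/2}ℓ³`
    have hB : (6 * 40 * 4 + 6 * 3) * (powScale 1 β * btLog β ^ 3) ≤ 1 / 2 * (powScale (1 / 2) β * btLog β ^ 3) := by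
      have hsplit : powScale 1 β = powScale (1 / 2) β * powScale (1 / 2) β := by rw [powScale_mul_powScale]; norm_num
      have hl3 : 0 ≤ powScale (1 / 2) β * btLog β ^ 3 := by positivity
      calc (6 * 40 * 4 + 6 * 3) * (powScale 1 β * btLog β ^ 3) = ((6 * 40 * 4 + 6 * 3) * powScale (1 / 2) β) * (powScale (1 / 2) β * btLog β ^ 3) := by rw [hsplit]; ring
        _ ≤ 1 / 2 * (powScale (1 / 2) β * btLog β ^ 3) := mul_le_mul_of_nonneg_right h2 hl3
        _ = 1 / 2 * (powScale (1 / 2) β * btLog β ^ 3) := by ring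
    have hle : (2 * ((4 + 48 * Ksp) * (8 * (9 * (L : ℝ) * (5 * (powScale (1 / 2) β * btLog β ^ 2)) + (powScale 1 β)))) + 6 * (40 * (4 * (powScale 1 β * btLog β ^ 3) ^ 2 + 2 * (powScale 1 β * btLog β ^ 3) * ((4 + 48 * Ksp) * (8 * (9 * (L : ℝ) * (5 * (powScale (1 / 2) β * btLog β ^ 2)) + (powScale 1 β))))) + 3 * (powScale 1 β * btLog β ^ 3))) ≤ (powScale (1 / 2) β * btLog β ^ 3) := by linarith [haw, hlin, hA, hB]
    refine ⟨hle, ?_⟩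
    have ha0 : 0 ≤ (2 * ((4 + 48 * Ksp) * (8 * (9 * (L : ℝ) * (5 * (powScale (1 / 2) β * btLog β ^ 2)) + (powScale 1 β)))) + 6 * (40 * (4 * (powScale 1 β * btLog β ^ 3) ^ 2 + 2 * (powScale 1 β * btLog β ^ 3) * ((4 + 48 * Ksp) * (8 * (9 * (L : ℝ) * (5 * (powScale (1 / 2) β * btLog β ^ 2)) + (powScale 1 β))))) + 3 * (powScale 1 β * btLog β ^ 3))) := by positivity
    have h4 : (2 * ((4 + 48 * Ksp) * (8 * (9 * (L : ℝ) * (5 * (powScale (1 / 2) β * btLog β ^ 2)) + (powScale 1 β)))) + 6 * (40 * (4 * (powScale 1 β * btLog β ^ 3) ^ 2 + 2 * (powScale 1 β * btLog β ^ 3) * ((4 + 48 * Ksp) * (8 * (9 * (L : ℝ) * (5 * (powScale (1 / 2) β * btLog β ^ 2)) + (powScale 1 β))))) + 3 * (powScale 1 β * btLog β ^ 3))) ^ 4 ≤ (powScale (1 / 2) β * btLog β ^ 3) ^ 4 := pow_le_pow_left₀ ha0 hle 4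
    have hsplit4 : (powScale (1 / 2) β * btLog β ^ 3) ^ 4 = powScale 1 β * (powScale 1 β * btLog β ^ 12) := by
      have h22 : powScale (1 / 2) β * powScale (1 / 2) β = powScale 1 β := by rw [powScale_mul_powScale]; norm_num
      calc (powScale (1 / 2) β * btLog β ^ 3) ^ 4 = (powScale (1 / 2) β * powScale (1 / 2) β) * (powScale (1 / 2) β * powScale (1 / 2) β) * btLog β ^ 12 := by ring
        _ = powScale 1 β * (powScale 1 β * btLog β ^ 12) := by rw [h22]; ring
    calc (L : ℝ) ^ 3 * (12 * (2 * ((4 + 48 * Ksp) * (8 * (9 * (L : ℝ) * (5 * (powScale (1 / 2) β * btLog β ^ 2)) + (powScale 1 β)))) + 6 * (40 * (4 * (powScale 1 β * btLog β ^ 3) ^ 2 + 2 * (powScale 1 β * btLog β ^ 3) * ((4 + 48 * Ksp) * (8 * (9 * (L : ℝ) * (5 * (powScale (1 / 2) β * btLog β ^ 2)) + (powScale 1 β))))) + 3 * (powScale 1 β * btLog β ^ 3))) ^ 4) ≤ (L : ℝ) ^ 3 * (12 * (powScale (1 / 2) β * btLog β ^ 3) ^ 4) :=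
          mul_le_mul_of_nonneg_left (mul_le_mul_of_nonneg_left h4 (by norm_num)) (pow_nonneg (Nat.cast_nonneg L) 3)
      _ = powScale 1 β * ((12 * (L : ℝ) ^ 3) * (powScale 1 β * btLog β ^ 12)) := by rw [hsplit4]; ring
      _ ≤ powScale 1 β * 1 := mul_le_mul_of_nonneg_left h3 hs1.le
      _ = (powScale 1 β) := mul_one _
  have e36 : ∀ᶠ β : ℝ in atTop, (Fintype.card (Edge 3 L) : ℝ) * (8 * (min (1 / 40) (powScale (1 / 2) β * btLog β)) + 2 * (powScale (1 / 2) β * btLog β ^ 3)) < 1 * powScale (1 / 4) β ∧ 8 * (min (1 / 40) (powScale (1 / 2) β * btLog β)) + 2 * (powScale (1 / 2) β * btLog β ^ 3) < M' * (1 * powScale (1 / 4) β) := by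
    have ha := eventually_mul_lt_of_tendsto (tendsto_powScale_mul_btLog_pow (p := 1 / 4) (by norm_num) 3) (10 * (Fintype.card (Edge 3 L) : ℝ)) (by norm_num : (0:ℝ) < 1)
    filter_upwards [ha] with β h1
    have hx0 : 0 < powScale (1 / 4) β := powScale_pos _ _
    have hℓ1 := one_le_btLog β
    have hℓ0 : 0 ≤ btLog β := le_trans zero_le_one hℓ1
    have hq : 0 ≤ powScale (1 / 4) β * btLog β ^ 3 := by positivity
    have hℓ3 : btLog β ≤ btLog β ^ 3 := by
      calc btLog β = btLog β * 1 * 1 := by ring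
        _ ≤ btLog β * btLog β * btLog β := by gcongr
        _ = btLog β ^ 3 := by ring
    have h22 : powScale (1 / 2) β = powScale (1 / 4) β * powScale (1 / 4) β := by rw [powScale_mul_powScale]; norm_num
    have hrf : (min (1 / 40) (powScale (1 / 2) β * btLog β)) ≤ powScale (1 / 4) β * (powScale (1 / 4) β * btLog β ^ 3) := by
      calc (min (1 / 40) (powScale (1 / 2) β * btLog β)) ≤ powScale (1 / 2) β * btLog β := min_le_right _ _
        _ ≤ powScale (1 / 2) β * btLog β ^ 3 := mul_le_mul_of_nonneg_left hℓ3 (powScale_pos _ _).le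
        _ = powScale (1 / 4) β * (powScale (1 / 4) β * btLog β ^ 3) := by rw [h22]; ring
    have hdu : (powScale (1 / 2) β * btLog β ^ 3) = powScale (1 / 4) β * (powScale (1 / 4) β * btLog β ^ 3) := by rw [h22]; ring
    have hsum : 8 * (min (1 / 40) (powScale (1 / 2) β * btLog β)) + 2 * (powScale (1 / 2) β * btLog β ^ 3) ≤ powScale (1 / 4) β * (10 * (powScale (1 / 4) β * btLog β ^ 3)) := by
      rw [hdu]; nlinarith [hrf, hq, hx0]
    have hE1 : (1 : ℝ) ≤ Fintype.card (Edge 3 L) := by exact_mod_cast Fintype.card_pos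
    have hkey : (Fintype.card (Edge 3 L) : ℝ) * (8 * (min (1 / 40) (powScale (1 / 2) β * btLog β)) + 2 * (powScale (1 / 2) β * btLog β ^ 3)) < 1 * powScale (1 / 4) β := by
      calc (Fintype.card (Edge 3 L) : ℝ) * (8 * (min (1 / 40) (powScale (1 / 2) β * btLog β)) + 2 * (powScale (1 / 2) β * btLog β ^ 3))
          ≤ (Fintype.card (Edge 3 L) : ℝ) * (powScale (1 / 4) β * (10 * (powScale (1 / 4) β * btLog β ^ 3))) := mul_le_mul_of_nonneg_left hsum (by positivity)
        _ = powScale (1 / 4) β * ((10 * (Fintype.card (Edge 3 L) : ℝ)) * (powScale (1 / 4) β * btLog β ^ 3)) := by ring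
        _ < powScale (1 / 4) β * 1 := mul_lt_mul_of_pos_left h1 hx0
        _ = 1 * powScale (1 / 4) β := by ring
    refine ⟨hkey, ?_⟩
    have h0 : 0 ≤ 8 * (min (1 / 40) (powScale (1 / 2) β * btLog β)) + 2 * (powScale (1 / 2) β * btLog β ^ 3) := by
      have h01 : 0 ≤ (min (1 / 40) (powScale (1 / 2) β * btLog β)) := le_min (by norm_num) (mul_nonneg (powScale_pos _ _).le hℓ0)
      have h02 : 0 ≤ (powScale (1 / 2) β * btLog β ^ 3) := mul_nonneg (powScale_pos _ _).le (pow_nonneg hℓ0 3)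
      linarith
    have hE : 8 * (min (1 / 40) (powScale (1 / 2) β * btLog β)) + 2 * (powScale (1 / 2) β * btLog β ^ 3) ≤ (Fintype.card (Edge 3 L) : ℝ) * (8 * (min (1 / 40) (powScale (1 / 2) β * btLog β)) + 2 * (powScale (1 / 2) β * btLog β ^ 3)) :=
      le_mul_of_one_le_left h0 hE1
    calc 8 * (min (1 / 40) (powScale (1 / 2) β * btLog β)) + 2 * (powScale (1 / 2) β * btLog β ^ 3) < 1 * powScale (1 / 4) β := lt_of_le_of_lt hE hkey
      _ ≤ M' * (1 * powScale (1 / 4) β) := by rw [one_mul]; nlinarith only [hM', hx0]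
  have e38 : ∀ᶠ β : ℝ in atTop, (powScale (1 / 2) β * btLog β ^ 3) ≤ 1 := by
    filter_upwards [eventually_mul_le_of_tendsto (tendsto_powScale_mul_btLog_pow (p := 1 / 2) (by norm_num) 3) 1 one_pos] with β h
    rw [one_mul] at h; exact h
  have e37 : ∀ᶠ β : ℝ in atTop, (min (1 / 40) (powScale (1 / 2) β * btLog β)) ≤ (9 * (L : ℝ) * (5 * (powScale (1 / 2) β * btLog β ^ 2)) + (powScale 1 β)) ∧ 3 * L * (5 * (powScale (1 / 2) β * btLog β ^ 2)) < 1 := by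
    have h3 := eventually_mul_lt_of_tendsto (tendsto_powScale_mul_btLog_pow (p := 1 / 2) (by norm_num) 2) (3 * (L : ℝ) * 5) one_pos
    filter_upwards [h3] with β h
    have hℓ := one_le_btLog β
    have hx0 : 0 < powScale (1 / 2) β := powScale_pos _ _
    have hL1 : (1 : ℝ) ≤ (L : ℝ) := by exact_mod_cast NeZero.one_le
    have h10 : 0 < powScale 1 β := powScale_pos _ _
    have hpl0 : 0 ≤ powScale (1 / 2) β * btLog β := mul_nonneg hx0.le (le_trans zero_le_one hℓ)
    constructor
    · calc (min (1 / 40) (powScale (1 / 2) β * btLog β)) ≤ powScale (1 / 2) β * btLog β := min_le_right _ _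
        _ = (powScale (1 / 2) β * btLog β) * 1 := (mul_one _).symm
        _ ≤ (powScale (1 / 2) β * btLog β) * btLog β := mul_le_mul_of_nonneg_left hℓ hpl0
        _ = 1 * (powScale (1 / 2) β * btLog β ^ 2) := by ring
        _ ≤ (45 * (L : ℝ)) * (powScale (1 / 2) β * btLog β ^ 2) := mul_le_mul_of_nonneg_right (by linarith only [hL1]) (by rw [sq, ← mul_assoc]; exact mul_nonneg hpl0 (le_trans zero_le_one hℓ))
        _ = 9 * (L : ℝ) * (5 * (powScale (1 / 2) β * btLog β ^ 2)) := by ring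
        _ ≤ (9 * (L : ℝ) * (5 * (powScale (1 / 2) β * btLog β ^ 2)) + (powScale 1 β)) := by linarith only [h10]
    · calc 3 * L * (5 * (powScale (1 / 2) β * btLog β ^ 2)) = (3 * (L : ℝ) * 5) * (powScale (1 / 2) β * btLog β ^ 2) := by ring
        _ < 1 := h
  -- ASSEMBLY
  filter_upwards [eventually_ge_atTop (max β₀ 1), e1, e2, e3, e4, e5, e6, e7, e8, e9, e10, e11, e12, e13, e14, e15, e16, e17, e18, e19, e22, e23, e24, e25, e26,
    e27, e28, e29, e30, e31, e32, e33, e34, e35, e36, e37, e38] with β hβm h1 h2 h3 h4 h5 h6 h7 h8 h9 h10 h11 h12 h13 h14 h15 h16 h17 h18 h19 h22 h23 h24 h25 h26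
    h27 h28 h29 h30 h31 h32 h33 h34 h35 h36 h37 h38
  intro v' hv' hv'T hx'
  have hβ1 : 1 ≤ β := le_trans (le_max_right _ _) hβm
  have hβ0 : β₀ ≤ β := le_trans (le_max_left _ _) hβm
  have hβ : 0 < β := by linarith only [hβ1]
  have hs1 : 0 < powScale 1 β := powScale_pos _ _
  have hℓ := one_le_btLog β
  have hℓ0 : 0 ≤ btLog β := le_trans zero_le_one hℓ
  have hx0 : 0 < powScale (1 / 2) β := powScale_pos _ _
  have hq0 : 0 < powScale (1 / 4) β := powScale_pos _ _
  obtain ⟨hρ0, -⟩ := schedRho_bounds (L := L) hβ1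
  have hL0 : (0 : ℝ) ≤ (L : ℝ) := Nat.cast_nonneg L
  have hpl2 : 0 ≤ powScale (1 / 2) β * btLog β ^ 2 := mul_nonneg hx0.le (pow_nonneg hℓ0 2)
  have hT0' : 0 ≤ (9 * (L : ℝ) * (5 * (powScale (1 / 2) β * btLog β ^ 2)) + (powScale 1 β)) := by
    have := mul_nonneg (mul_nonneg (by norm_num : (0:ℝ) ≤ 9) hL0) (mul_nonneg (by norm_num : (0:ℝ) ≤ 5) hpl2)
    linarith only [this, hs1]
  have hρpos : 0 < (8 * (9 * (L : ℝ) * (5 * (powScale (1 / 2) β * btLog β ^ 2)) + (powScale 1 β))) := by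
    have := mul_nonneg (mul_nonneg (by norm_num : (0:ℝ) ≤ 9) hL0) (mul_nonneg (by norm_num : (0:ℝ) ≤ 5) hpl2)
    linarith only [this, hs1]
  have hr0 : 0 ≤ (powScale 1 β * btLog β ^ 3) := mul_nonneg hs1.le (pow_nonneg hℓ0 3)
  have hrf0 : 0 ≤ (min (1 / 40) (powScale (1 / 2) β * btLog β)) := le_min (by norm_num) (mul_nonneg hx0.le hℓ0)
  rw [one_mul] at h10 h16 h17 h24 h25 h27 h28
  -- the data
  have hqfm : ∀ β', Measurable ((fun β'' : ℝ => stiffGaussExp L (β'' / 2) β'') β') := fun β' => measurable_stiffGaussExp _ _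
  have hqf0 : ∀ β' x, 0 ≤ (fun β'' : ℝ => stiffGaussExp L (β'' / 2) β'') β' x := fun β' x => stiffGaussExp_nonneg _ _ x
  have hqfinv : ∀ β' (g : SU2) (x : LinkSpace L), (fun β'' : ℝ => stiffGaussExp L (β'' / 2) β'') β' (adL L g x) = (fun β'' : ℝ => stiffGaussExp L (β'' / 2) β'') β' x :=
    fun β' g x => stiffGaussExp_adL _ _ g x
  have hχm := measurable_slowWindow (L := L) (powScale (1 / 2) β * btLog β ^ 3) (powScale 1 β)
  have hχ0 : ∀ u, 0 ≤ {u : GaugeConfig 3 1 SU2 | (∀ k : Fin 3, ‖su2Quat (u (0, k)) - 1‖ ≤ (powScale (1 / 2) β * btLog β ^ 3)) ∧ (L : ℝ) ^ 3 * wilsonAction su2Rep u ≤ (powScale 1 β)}.indicator (fun _ => (1 : ℝ)) u := fun u => (slowWindow_mem_Icc (L := L) _ _ u).1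
  have hCχ : ∀ u, {u : GaugeConfig 3 1 SU2 | (∀ k : Fin 3, ‖su2Quat (u (0, k)) - 1‖ ≤ (powScale (1 / 2) β * btLog β ^ 3)) ∧ (L : ℝ) ^ 3 * wilsonAction su2Rep u ≤ (powScale 1 β)}.indicator (fun _ => (1 : ℝ)) u ≤ 1 := fun u => (slowWindow_mem_Icc (L := L) _ _ u).2.1
  have hχinv := slowWindow_conj (L := L) (powScale (1 / 2) β * btLog β ^ 3) (powScale 1 β)
  have hΩGm : Measurable (frozenProfile L (fun β' => stiffGaussExp L (β' / 2) β') (fun β' => min (1 / 40) (powScale (1 / 2) β' * btLog β')) β) :=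
    measurable_frozenProfile hqfm _ β
  have hΩG0 : ∀ x, 0 ≤ frozenProfile L (fun β' => stiffGaussExp L (β' / 2) β') (fun β' => min (1 / 40) (powScale (1 / 2) β' * btLog β')) β x :=
    fun x => (frozenProfile_mem_Icc hqf0 _ β x).1
  have hΩG1 : ∀ x, |frozenProfile L (fun β' => stiffGaussExp L (β' / 2) β') (fun β' => min (1 / 40) (powScale (1 / 2) β' * btLog β')) β x| ≤ 1 := abs_frozenProfile_le hqf0 _ β
  have hΩm := measurable_capRestrict (L := L) hΩGm
  have hΩdat := fun x => capRestrict_mem (L := L) hΩG0 hΩG1 x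
  have hbo := boFun_support_recordChi (L := L) (s := 1 / 4) (K := 1) (M := M') (β := β) (χ₀ := {u : GaugeConfig 3 1 SU2 | (∀ k : Fin 3, ‖su2Quat (u (0, k)) - 1‖ ≤ (powScale (1 / 2) β * btLog β ^ 3)) ∧ (L : ℝ) ^ 3 * wilsonAction su2Rep u ≤ (powScale 1 β)}.indicator (fun _ => (1 : ℝ)))
    (Ω := frozenProfile L (fun β' => stiffGaussExp L (β' / 2) β') (fun β' => min (1 / 40) (powScale (1 / 2) β' * btLog β')) β) hrf0 (by linarith [min_le_left (1 / 40 : ℝ) (powScale (1 / 2) β * btLog β)])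
    (fun u hu => (slowWindow_support (L := L) _ _ u hu).1) (fun x hx => norm_le_of_frozenProfile_ne_zero _ _ β hx) h36.1 h36.2
  have hWc := fun g (hg : coreWeight L (powScale 1 β) (5 * (powScale (1 / 2) β * btLog β ^ 2)) g ≠ 0) => coreWeight_support (L := L) hs1.le h37.2 hg
  have hZ := fpWeight_orbit (L := L) (powScale 1 β)
  have hI0 := slowWindow_I0_pos (L := L) (δu := (powScale (1 / 2) β * btLog β ^ 3)) (σ := (powScale 1 β)) (mul_pos (powScale_pos _ _) (pow_pos (lt_of_lt_of_le one_pos (one_le_btLog β)) 3)) (powScale_pos _ _) ((L : ℝ) ^ 3 * β)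
  have hΩt : ∀ v : Edge 3 L → Fin 3 → ℝ, (fun x : LinkSpace L => {x : LinkSpace L | linkCurry x ∈ capBalancedSet L}.indicator (fun _ => (1 : ℝ)) x *
      frozenProfile L (fun β' => stiffGaussExp L (β' / 2) β') (fun β' => min (1 / 40) (powScale (1 / 2) β' * btLog β')) β x) (linkEmbed L v) ≠ 0 →
      v ∈ capBalancedSet L ∧ (∀ (e : Edge 3 L) (c : Fin 3), |v e c| ≤ (9 * (L : ℝ) * (5 * (powScale (1 / 2) β * btLog β ^ 2)) + (powScale 1 β))) ∧ ‖linkEmbed L v‖ ≤ (min (1 / 40) (powScale (1 / 2) β * btLog β)) := fun v hv => by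
    obtain ⟨hcap, hvc, hvn⟩ := capRestrict_frozenProfile_support (L := L) _ _ β v hv
    exact ⟨hcap, fun e c => (hvc e c).trans h37.1, hvn⟩
  have hNbar := fpWeightBar_pos L hs1
  -- (P)
  have hPβ := hP β hβ0
  refine central_transfer_two_sided_chart_sharp (L := L) hL hβ hs1 hKsp hSP hMT hεT hT hC hI hKD hD hB0 hB hCL hLip hqfm hqf0 hqfinv rfl hχm hχ0 hCχ hχinv hbo hΩm
    (fun x => (hΩdat x).2.2) (fun x => (hΩdat x).1) (boFun_capRestrict _ _) (fpZ_pos hs1).le hZ h38 hT0' h16 (powScale_pos _ _).le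
    (lt_of_le_of_lt (powScale_le_one (by norm_num) β) (by norm_num)) hΩt hWc (fun u hu => slowWindow_support (L := L) _ _ u hu) hI0 hv' hv'T hx'
    (by linarith only [hrf0]) (fun U hU => (hPβ U hU).1) (fun U hU => (hPβ U hU).2) hρpos h10 le_rfl ?_ h11 h12 ?_ h1 h2 h3 h4 h5 h6 h7 h8 ?_ h18 (by rw [one_mul]; exact h19)
    ?_ hr0 ?_ h24 h25 ?_ (by linarith only [hr0]) ?_ h30 zero_le_one h17 ?_ ?_ h14 ?_ h27 h28 ?_ h32 ?_
  · -- hR₀ : 6T²·(r_f/12) ≤ (9/10) r_f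
    have hT1 : (9 * (L : ℝ) * (5 * (powScale (1 / 2) β * btLog β ^ 2)) + (powScale 1 β)) ≤ 1 := by linarith only [h16]
    have hT2 : (9 * (L : ℝ) * (5 * (powScale (1 / 2) β * btLog β ^ 2)) + (powScale 1 β)) ^ 2 ≤ 1 := by nlinarith only [hT1, hT0']
    nlinarith only [hT2, hrf0]
  · -- hR50
    have hρ1 : (8 * (9 * (L : ℝ) * (5 * (powScale (1 / 2) β * btLog β ^ 2)) + (powScale 1 β))) ≤ 1 := by linarith only [h10]
    calc ((2 + 24 * Ksp) * (8 * (9 * (L : ℝ) * (5 * (powScale (1 / 2) β * btLog β ^ 2)) + (powScale 1 β)))) ^ 2 / 4 = (2 + 24 * Ksp) ^ 2 / 4 * (8 * (9 * (L : ℝ) * (5 * (powScale (1 / 2) β * btLog β ^ 2)) + (powScale 1 β))) * (8 * (9 * (L : ℝ) * (5 * (powScale (1 / 2) β * btLog β ^ 2)) + (powScale 1 β))) := by ring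
      _ ≤ (2 + 24 * Ksp) ^ 2 / 4 * (8 * (9 * (L : ℝ) * (5 * (powScale (1 / 2) β * btLog β ^ 2)) + (powScale 1 β))) * 1 := mul_le_mul_of_nonneg_left hρ1 (mul_nonneg (by positivity) hρ0)
      _ ≤ 1 / 50 := by linarith only [h13]
  · -- h9
    have hρ1 : (8 * (9 * (L : ℝ) * (5 * (powScale (1 / 2) β * btLog β ^ 2)) + (powScale 1 β))) ≤ 1 := by linarith only [h10]
    calc KD * ((4 + 48 * Ksp) * (8 * (9 * (L : ℝ) * (5 * (powScale (1 / 2) β * btLog β ^ 2)) + (powScale 1 β)))) ^ 2 ≤ |KD| * ((4 + 48 * Ksp) * (8 * (9 * (L : ℝ) * (5 * (powScale (1 / 2) β * btLog β ^ 2)) + (powScale 1 β)))) ^ 2 := mul_le_mul_of_nonneg_right (le_abs_self _) (sq_nonneg _)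
      _ = |KD| * (4 + 48 * Ksp) ^ 2 * (8 * (9 * (L : ℝ) * (5 * (powScale (1 / 2) β * btLog β ^ 2)) + (powScale 1 β))) * (8 * (9 * (L : ℝ) * (5 * (powScale (1 / 2) β * btLog β ^ 2)) + (powScale 1 β))) := by ring
      _ ≤ |KD| * (4 + 48 * Ksp) ^ 2 * (8 * (9 * (L : ℝ) * (5 * (powScale (1 / 2) β * btLog β ^ 2)) + (powScale 1 β))) * 1 := mul_le_mul_of_nonneg_left hρ1 (mul_nonneg (by positivity) hρ0)
      _ ≤ 1 / 2 := by linarith only [h9]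
  · -- hρ₁
    have : (3 + 24 * Ksp) * (8 * (9 * (L : ℝ) * (5 * (powScale (1 / 2) β * btLog β ^ 2)) + (powScale 1 β))) - (2 + 24 * Ksp) * (8 * (9 * (L : ℝ) * (5 * (powScale (1 / 2) β * btLog β ^ 2)) + (powScale 1 β))) = (8 * (9 * (L : ℝ) * (5 * (powScale (1 / 2) β * btLog β ^ 2)) + (powScale 1 β))) := by ring
    linarith only [this, hρpos]
  · -- hrR : r ≤ R₁
    have hL1 : (1 : ℝ) ≤ (L : ℝ) := by exact_mod_cast NeZero.one_le
    have h1' : 0 ≤ ((3 + 24 * Ksp) * (8 * (9 * (L : ℝ) * (5 * (powScale (1 / 2) β * btLog β ^ 2)) + (powScale 1 β)))) := mul_nonneg (by linarith only [hKsp]) hρ0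
    have h2' : 0 ≤ (M' * (1 * powScale (1 / 4) β)) := by rw [one_mul]; exact mul_nonneg (by linarith only [hM']) hq0.le
    have h3' : 0 ≤ 3 * ((L : ℝ) - 1) * (((3 + 24 * Ksp) * (8 * (9 * (L : ℝ) * (5 * (powScale (1 / 2) β * btLog β ^ 2)) + (powScale 1 β)))) + (M' * (1 * powScale (1 / 4) β))) := mul_nonneg (by linarith only [hL1]) (add_nonneg h1' h2')
    linarith only [h3']
  · -- hcore : ρ₁ + 8r ≤ M'·(1·β^{-1/4})
    rw [one_mul]; linarith only [h22, h23]
  · -- hθ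
    calc (MT + 2 * B) * (3 * ((L : ℝ) - 1) * (((3 + 24 * Ksp) * (8 * (9 * (L : ℝ) * (5 * (powScale (1 / 2) β * btLog β ^ 2)) + (powScale 1 β)))) + (M' * (1 * powScale (1 / 4) β))) + (powScale 1 β * btLog β ^ 3)) * (4 * sliceConst L) = ((MT + 2 * B) * (4 * sliceConst L)) * (3 * ((L : ℝ) - 1) * (((3 + 24 * Ksp) * (8 * (9 * (L : ℝ) * (5 * (powScale (1 / 2) β * btLog β ^ 2)) + (powScale 1 β)))) + (M' * (1 * powScale (1 / 4) β))) + (powScale 1 β * btLog β ^ 3)) := by ring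
      _ ≤ 1 / 4 := h26
  · -- hχlo : floor on the sharp window
    intro u hu hS
    exact slowWindow_floor (L := L) h35.1 h35.2 u hu hS
  · -- hrf : profile radius
    rw [h34]
    have hring : 14 * (Fintype.card (Edge 3 L) : ℝ) * (8 * (9 * (L : ℝ) * (5 * (powScale (1 / 2) β * btLog β ^ 2)) + (powScale 1 β))) ^ 2 + (CL * ((4 + 48 * Ksp) * (8 * (9 * (L : ℝ) * (5 * (powScale (1 / 2) β * btLog β ^ 2)) + (powScale 1 β)))) * (9 * Ksp * (8 * (9 * (L : ℝ) * (5 * (powScale (1 / 2) β * btLog β ^ 2)) + (powScale 1 β)))) + MT * (9 * Ksp * (8 * (9 * (L : ℝ) * (5 * (powScale (1 / 2) β * btLog β ^ 2)) + (powScale 1 β)))) ^ 2) + (B * (powScale 1 β * btLog β ^ 3) + MT * (powScale 1 β * btLog β ^ 3) ^ 2) =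
        (14 * (Fintype.card (Edge 3 L) : ℝ) + CL * (4 + 48 * Ksp) * (9 * Ksp) + MT * (9 * Ksp) ^ 2) * (8 * (9 * (L : ℝ) * (5 * (powScale (1 / 2) β * btLog β ^ 2)) + (powScale 1 β))) ^ 2 + B * (powScale 1 β * btLog β ^ 3) + MT * (powScale 1 β * btLog β ^ 3) ^ 2 := by ring
    linarith only [hring, h31]
  · -- hboot'
    calc 4 * sliceConst L * MT * (9 * Ksp * (8 * (9 * (L : ℝ) * (5 * (powScale (1 / 2) β * btLog β ^ 2)) + (powScale 1 β)))) = (4 * sliceConst L * MT * (9 * Ksp)) * (8 * (9 * (L : ℝ) * (5 * (powScale (1 / 2) β * btLog β ^ 2)) + (powScale 1 β))) := by ring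
      _ ≤ 1 / 2 := h15
  · -- hbootb
    calc 4 * sliceConst L * MT * (3 * ((L : ℝ) - 1) * (((3 + 24 * Ksp) * (8 * (9 * (L : ℝ) * (5 * (powScale (1 / 2) β * btLog β ^ 2)) + (powScale 1 β)))) + (M' * (1 * powScale (1 / 4) β)))) = (4 * sliceConst L * MT) * (3 * ((L : ℝ) - 1) * (((3 + 24 * Ksp) * (8 * (9 * (L : ℝ) * (5 * (powScale (1 / 2) β * btLog β ^ 2)) + (powScale 1 β)))) + (M' * (1 * powScale (1 / 4) β)))) := by ring
      _ ≤ 1 / 2 := h29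
  · -- hNT : T_b ≤ N_lo
    rw [one_mul]
    have hfac := mul_le_mul_of_nonneg_right h33 hNbar.le
    rw [add_mul, one_mul] at hfac
    linarith only [hfac]

end Summit.QuantumFields.YangMills.Theorems.FemtoTransferGap.TwoLattice.ConstTube

end
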